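import Literature.Probability.Divergences.KLDivConvexity
import Literature.Analysis.FluidPDE.HardSphereDynamics
import Literature.MathematicalPhysics.KineticTheory.HardSphereEuler
import HarnessLib

/-!
# Crux `NearConstantShortTimeHL` (stmt-AtomisticToContinuum-12502), line `small-tilt-domination` — the entropy inequality for a static functional along the flow

Lead c2, helper of `stub_gronwallAssembly`, step (4) of the architecture: the expectation under the TRUE law at time `r` of a bounded
nonnegative STATIC functional `G` (in the assembly: the capped mesoscale `fluctuation` at the Euler fields of time `r`) is priced by the
relative entropy of the evolved law against the matched reference plus the reference's exponential moment:
`E_P[G ∘ Φ_r] ≤ c⁻¹ (KL((Φ_r)_* P ‖ Q) + log E_Q e^{c G})` for every `c > 0` — the Gibbs / Donsker–Varadhan inequality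
(`Literature.Probability.Divergences.integral_le_toReal_klDiv_add_log`) for the push-forward law. No domination and no dynamics enter:
this is why the quadratic flux remainder carries no `a²/γ` floor.
-/

noncomputable section

namespace Summit.AtomisticToContinuum.HydrodynamicLimit.Theorems.NearConstantShortTimeHL

open scoped BigOperators ENNReal
open MeasureTheory Set Filter InformationTheory
open Literature.MathematicalPhysics.KineticTheory Literature.Analysis.FluidPDE Literature.Analysis.FunctionSpaces
open Literature.Probability.Divergences (integral_le_toReal_klDiv_add_log)

/-- **Entropy inequality for a bounded static functional along the flow.** For a hard-sphere flow `Φ`, a probability law `P` of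
initial data, a probability reference `Q` with `KL((Φ_r)_* P ‖ Q) < ∞`, a measurable functional `G` with `0 ≤ G ≤ B`, and `c > 0`:
`∫ G (Φ_r z) dP(z) ≤ c⁻¹ · (KL((Φ_r)_* P ‖ Q) + log ∫ e^{c G} dQ)`. [cite: KipnisLandim1999, Appendix 1 Thm. 8.3] -/
theorem integral_comp_flow_le_klDiv_add_log : ∀ {ε : ℝ} {n : ℕ} (Φ : HardSphereFlow (Torus.geometry (Fin 3)) ε n)
    (P Q : Measure (Config n (Fin 3) T3)) [IsProbabilityMeasure P] [IsProbabilityMeasure Q] (r : ℝ),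
    klDiv (Φ.lawAt P r) Q ≠ ∞ → ∀ {G : Config n (Fin 3) T3 → ℝ}, Measurable G → ∀ {B : ℝ}, (∀ w, 0 ≤ G w ∧ G w ≤ B) →
    ∀ {c : ℝ}, 0 < c →
      ∫ z, G (Φ.flow r z) ∂P ≤ c⁻¹ * ((klDiv (Φ.lawAt P r) Q).toReal + Real.log (∫ w, Real.exp (c * G w) ∂Q)) := by
  intro ε n Φ P Q _ _ r hfin G hG B hB c hc
  haveI : IsProbabilityMeasure (Φ.lawAt P r) := by
    rw [HardSphereFlow.lawAt_eq]
    exact Measure.isProbabilityMeasure_map (Φ.measurable_flow r).aemeasurable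
  -- Donsker–Varadhan for the push-forward law and `ψ = c G`
  have hψ : Measurable fun w => c * G w := measurable_const.mul hG
  have hbound : ∀ w, |c * G w| ≤ c * B := fun w => by
    rw [abs_of_nonneg (mul_nonneg hc.le (hB w).1)]
    exact mul_le_mul_of_nonneg_left (hB w).2 hc.le
  have hDV := integral_le_toReal_klDiv_add_log (μ := Φ.lawAt P r) (ν := Q) hfin hψ hbound
  -- the push-forward integral is the integral along the flow
  have hmap : ∫ w, c * G w ∂(Φ.lawAt P r) = c * ∫ z, G (Φ.flow r z) ∂P := by
    rw [HardSphereFlow.lawAt_eq, integral_map (Φ.measurable_flow r).aemeasurable hψ.aestronglyMeasurable, integral_const_mul]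
  rw [hmap] at hDV
  rw [le_inv_mul_iff₀ hc]
  linarith

end Summit.AtomisticToContinuum.HydrodynamicLimit.Theorems.NearConstantShortTimeHL

end
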